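import Mathlib
import Summits.Ventures.PercRepro0.Defs
import Summits.Ventures.PercRepro0.Events
import Summits.Ventures.PercRepro0.Coupling

/-!
# S5 · PC-CHI on the cell's definitions: the susceptibility threshold equals `p_c` (seat p3)

The print behind H1 (Fitzner–van der Hofstad 2017) evaluates the triangle condition at ITS critical
point `p_c^χ = sup {p : χ(p) < ∞}` ((1.4) there), while the route's `Defs.pc` is `inf {p : θ(p) > 0}`.
The identification is S5 · PC-CHI (proofs/PCCHI-p4-v1.md, Theorem 1); this module is its Lean twin:

* `chi d p = Σ_x P_p(0 ↔ x)` (`ℝ≥0∞`-valued, so `χ = ∞` is a value, not a side condition);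
  `chiSet d = {p ∈ [0,1] : χ_d(p) < ∞}`; `pcChi d = sup (chiSet d)`;
* `H1_TriangleChi11` — H1 stated at `p_c^χ`, the print verbatim;
* `chi_eq_top_of_thetaI_pos` — `θ_d(p) > 0 ⇒ χ_d(p) = ∞` (Tonelli: `χ = E|C(0)|`, and `|C(0)| = ∞`
  on `{0 ↔ ∞}`); hence `pcChi_le_pc` (`d ≥ 1`; no FKG, no uniqueness);
* `chi_lt_top_of_lt_pc` — below `p_c`, S1′ (`Defs.P5_Sharpness d`) gives
  `P_p(0 ↔ x) ≤ exp(−c‖x‖_∞)` and the layer count `|{‖x‖_∞ ≤ n}| = (2n+1)^d` makes `χ` finite;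
  hence `pc_le_pcChi`;
* `pcChi_eq_pc (hd : 1 ≤ d) (hP5 : P5_Sharpness d) : pcChi d = pc d` — S5, and
  `H1_Triangle11_of_chi` — H1 at `p_c^χ` transfers to `Defs.H1_Triangle11` given sharpness in every
  dimension `d ≥ 11` (the honest hypothesis form for the certificate).

Inputs: `Defs`, `Events` (measurability, `cluster_empty`, `pc` bounds), `Coupling`
(`theta_pos_of_pc_lt'`). Nothing is claimed about the value of `pcChi` beyond these lemmas.
-/

namespace Summit.Ventures.PercRepro0.PcChi

open MeasureTheory ProbabilityTheory unitInterval Defs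
open scoped ENNReal

variable {d : ℕ}

/-! ## The susceptibility and the print's critical point -/

/-- The susceptibility `χ_d(p) = Σ_x τ_p(0,x) = E_p|C(0)|`, as an extended non-negative real. -/
noncomputable def chi (d : ℕ) (p : I) : ℝ≥0∞ := ∑' x : Vertex d, P d p {ω | Conn d ω 0 x}

/-- `{p ∈ [0,1] : χ_d(p) < ∞}`. -/
def chiSet (d : ℕ) : Set ℝ := {p : ℝ | p ∈ Set.Icc (0 : ℝ) 1 ∧ chi d (clamp p) < ⊤}

/-- The print's critical point `p_c^χ(d) = sup {p ∈ [0,1] : χ_d(p) < ∞}` (FvdH 2017, (1.4)). -/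
noncomputable def pcChi (d : ℕ) : ℝ := sSup (chiSet d)

/-- H1 at the print's point of evaluation: the triangle condition holds at `p_c^χ(d)` for every
`d ≥ 11` (FvdH 2017 Corollary 1.3 with (1.4), verbatim). -/
def H1_TriangleChi11 : Prop := ∀ d : ℕ, 11 ≤ d → TriangleCondition d (clamp (pcChi d))

/-! ## `χ = ∞` above `p_c` (Tonelli) -/

/-- `χ_d(p) = ∫ Σ_x 1{0 ↔ x} dP_p` (Tonelli for the non-negative series). -/
theorem chi_eq_lintegral (p : I) :
    chi d p = ∫⁻ ω, (∑' x : Vertex d,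
      ({ω : Config d | Conn d ω 0 x}).indicator (1 : Config d → ℝ≥0∞) ω) ∂(P d p) := by
  unfold chi
  rw [lintegral_tsum fun x => (measurable_one.indicator (measurableSet_conn 0 x)).aemeasurable]
  exact tsum_congr fun x => (lintegral_indicator_one (measurableSet_conn 0 x)).symm

/-- On `{0 ↔ ∞}` the integrand `Σ_x 1{0 ↔ x} = |C(0)|` is infinite. -/
theorem tsum_indicator_eq_top {ω : Config d} (hω : ω ∈ percolates d) :
    (∑' x : Vertex d, ({ω : Config d | Conn d ω 0 x}).indicator (1 : Config d → ℝ≥0∞) ω) = ⊤ := by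
  have h1 : (fun x : Vertex d => ({ω : Config d | Conn d ω 0 x}).indicator (1 : Config d → ℝ≥0∞) ω)
      = (cluster d ω 0).indicator (fun _ => (1 : ℝ≥0∞)) := by
    funext x
    by_cases hx : Conn d ω 0 x
    · rw [Set.indicator_of_mem (show ω ∈ {ω : Config d | Conn d ω 0 x} from hx),
        Set.indicator_of_mem (show x ∈ cluster d ω 0 from hx)]
      rfl
    · rw [Set.indicator_of_notMem (show ω ∉ {ω : Config d | Conn d ω 0 x} from hx),
        Set.indicator_of_notMem (show x ∉ cluster d ω 0 from hx)]
  rw [h1, ← tsum_subtype]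
  haveI : Infinite (cluster d ω 0) := Set.infinite_coe_iff.2 hω
  exact ENNReal.tsum_const_eq_top_of_ne_zero one_ne_zero

/-- `θ_d(p) > 0 ⇒ χ_d(p) = ∞`: `E|C(0)| ≥ ∞ · P_p(0 ↔ ∞)`. -/
theorem chi_eq_top_of_thetaI_pos (p : I) (h : 0 < thetaI d p) : chi d p = ⊤ := by
  rw [chi_eq_lintegral]
  refine lintegral_eq_top_of_measure_eq_top_ne_zero ?_ ?_
  · exact (Measurable.tsum fun x =>
      measurable_one.indicator (measurableSet_conn 0 x)).aemeasurable
  · have hsub : percolates d ⊆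
        {ω | (∑' x : Vertex d,
          ({ω : Config d | Conn d ω 0 x}).indicator (1 : Config d → ℝ≥0∞) ω) = ⊤} :=
      fun _ hω => tsum_indicator_eq_top hω
    have hpos : P d p (percolates d) ≠ 0 := by
      intro h0
      unfold thetaI at h
      rw [h0, ENNReal.toReal_zero] at h
      exact lt_irrefl _ h
    exact fun h0 => hpos (measure_mono_null hsub h0)

/-- `χ_d(0) = 1`: under `P_0` every bond is closed and `C(0) = {0}`. -/
theorem chi_zero : chi d 0 = 1 := by
  classical
  unfold chi P
  rw [setBernoulli_zero]
  have hc : ∀ x : Vertex d, Conn d (∅ : Config d) 0 x ↔ x = 0 := by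
    intro x
    have h := cluster_empty (d := d) (0 : Vertex d)
    have : x ∈ cluster d ∅ 0 ↔ x ∈ ({0} : Set (Vertex d)) := by rw [h]
    simpa [cluster] using this
  have hd' : ∀ x : Vertex d, Measure.dirac (∅ : Config d) {ω | Conn d ω 0 x}
      = if x = 0 then 1 else 0 := by
    intro x
    rw [Measure.dirac_apply' _ (measurableSet_conn 0 x), Set.indicator_apply]
    simp only [Set.mem_setOf_eq, Pi.one_apply, hc]
  simp_rw [hd']
  simp

/-- `0 ∈ chiSet d`. -/
theorem zero_mem_chiSet : (0 : ℝ) ∈ chiSet d := by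
  refine ⟨⟨le_rfl, zero_le_one⟩, ?_⟩
  rw [clamp_zero, chi_zero]
  exact ENNReal.one_lt_top

/-- `chiSet d` is bounded above by `1`. -/
theorem chiSet_bddAbove : BddAbove (chiSet d) := ⟨1, fun _ hp => hp.1.2⟩

/-- `chiSet d` is non-empty. -/
theorem chiSet_nonempty : (chiSet d).Nonempty := ⟨0, zero_mem_chiSet⟩

/-- `0 ≤ p_c^χ(d)`. -/
theorem pcChi_nonneg : 0 ≤ pcChi d := le_csSup chiSet_bddAbove zero_mem_chiSet

/-- `p_c^χ(d) ≤ 1`. -/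
theorem pcChi_le_one : pcChi d ≤ 1 := csSup_le chiSet_nonempty fun _ hp => hp.1.2

/-- `p_c^χ(d) ≤ p_c(d)` for `d ≥ 1`: above `p_c` the susceptibility is infinite
(no FKG and no uniqueness are used). -/
theorem pcChi_le_pc (hd : 1 ≤ d) : pcChi d ≤ pc d := by
  refine csSup_le chiSet_nonempty fun p hp => ?_
  by_contra hlt
  have hlt' : pc d < p := not_le.1 hlt
  have hθ : 0 < theta d p := theta_pos_of_pc_lt' hd hlt' hp.1.2
  have htop : chi d (clamp p) = ⊤ := chi_eq_top_of_thetaI_pos (clamp p) hθ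
  have := hp.2
  rw [htop] at this
  exact lt_irrefl _ this

/-! ## `χ < ∞` below `p_c` (sharpness and the layer count) -/

/-- The sup norm `‖x‖_∞` of a lattice point, as a natural number. -/
def nrm (x : Vertex d) : ℕ := Finset.univ.sup fun i => (x i).natAbs

/-- `|x_i| ≤ ‖x‖_∞`. -/
theorem natAbs_le_nrm (x : Vertex d) (i : Fin d) : (x i).natAbs ≤ nrm x :=
  Finset.le_sup (f := fun i => (x i).natAbs) (Finset.mem_univ i)

/-- `|x_i| ≤ ‖x‖_∞` as integers. -/
theorem abs_le_nrm (x : Vertex d) (i : Fin d) : |x i| ≤ (nrm x : ℤ) := by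
  rw [Int.abs_eq_natAbs]
  exact_mod_cast natAbs_le_nrm x i

/-- Some coordinate attains `‖x‖_∞` (`d ≥ 1`). -/
theorem exists_natAbs_eq_nrm (hd : 1 ≤ d) (x : Vertex d) : ∃ i, (x i).natAbs = nrm x := by
  obtain ⟨i, _, hi⟩ := Finset.exists_mem_eq_sup (Finset.univ : Finset (Fin d))
    (Finset.univ_nonempty_iff.2 ⟨⟨0, hd⟩⟩) fun i => (x i).natAbs
  exact ⟨i, hi.symm⟩

/-- `x ∈ ∂Λ_{‖x‖_∞}` (`d ≥ 1`). -/
theorem mem_boundary_nrm (hd : 1 ≤ d) (x : Vertex d) : x ∈ boundary d (nrm x) := by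
  refine ⟨fun i => abs_le_nrm x i, ?_⟩
  obtain ⟨i, hi⟩ := exists_natAbs_eq_nrm hd x
  exact ⟨i, by rw [Int.abs_eq_natAbs, hi]⟩

/-- `{0 ↔ x} ⊆ {0 ↔ ∂Λ_{‖x‖_∞}}` (`d ≥ 1`). -/
theorem conn_subset_toBoundary (hd : 1 ≤ d) (x : Vertex d) :
    {ω : Config d | Conn d ω 0 x} ⊆ toBoundary d (nrm x) :=
  fun _ hω => ⟨x, mem_boundary_nrm hd x, hω⟩

/-- Below `p_c`, S1′ gives `P_p(0 ↔ x) ≤ exp(−c ‖x‖_∞)` for some `c > 0`, uniformly in `x`. -/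
theorem exists_decay (hd : 1 ≤ d) (hP5 : P5_Sharpness d) (p : I) (hp : (p : ℝ) < pc d) :
    ∃ c : ℝ, 0 < c ∧ ∀ x : Vertex d,
      P d p {ω | Conn d ω 0 x} ≤ ENNReal.ofReal (Real.exp (-(c * nrm x))) := by
  obtain ⟨c, hc, hdecay⟩ := hP5 p hp
  refine ⟨c, hc, fun x => ?_⟩
  by_cases hx : nrm x = 0
  · rw [hx]
    simp only [Nat.cast_zero, mul_zero, neg_zero, Real.exp_zero, ENNReal.ofReal_one]
    exact prob_le_one
  · have h1 : 1 ≤ nrm x := Nat.one_le_iff_ne_zero.2 hx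
    calc P d p {ω | Conn d ω 0 x} ≤ P d p (toBoundary d (nrm x)) :=
          measure_mono (conn_subset_toBoundary hd x)
      _ = ENNReal.ofReal (P d p (toBoundary d (nrm x))).toReal :=
          (ENNReal.ofReal_toReal (measure_ne_top _ _)).symm
      _ ≤ ENNReal.ofReal (Real.exp (-(c * nrm x))) :=
          ENNReal.ofReal_le_ofReal (hdecay (nrm x) h1)

/-- The box `Λ_n = [−n, n]^d` as a `Finset`. -/
noncomputable def boxF (d n : ℕ) : Finset (Vertex d) := Fintype.piFinset fun _ : Fin d => Finset.Icc (-(n : ℤ)) n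

/-- `x ∈ Λ_n ↔ ‖x‖_∞ ≤ n`. -/
theorem mem_boxF {n : ℕ} {x : Vertex d} : x ∈ boxF d n ↔ nrm x ≤ n := by
  simp only [boxF, Fintype.mem_piFinset, Finset.mem_Icc]
  constructor
  · intro h
    refine Finset.sup_le fun i _ => ?_
    have := h i
    omega
  · intro h i
    have := natAbs_le_nrm x i
    omega

/-- `|Λ_n| = (2n+1)^d`. -/
theorem card_boxF (d n : ℕ) : (boxF d n).card = (2 * n + 1) ^ d := by
  rw [boxF, Fintype.card_piFinset]
  simp only [Int.card_Icc, Finset.prod_const, Finset.card_univ, Fintype.card_fin]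
  congr 1
  omega

/-- Layer decomposition and the box count: `Σ_x g(‖x‖_∞) ≤ Σ_n (2n+1)^d g(n)` in `ℝ≥0∞`. -/
theorem tsum_nrm_le (g : ℕ → ℝ≥0∞) :
    ∑' x : Vertex d, g (nrm x) ≤ ∑' n : ℕ, (((2 * n + 1) ^ d : ℕ) : ℝ≥0∞) * g n := by
  classical
  have h1 : ∀ x : Vertex d, g (nrm x) = ∑' n : ℕ, if nrm x = n then g n else 0 := by
    intro x
    exact (tsum_ite_eq' (nrm x) g).symm
  calc ∑' x : Vertex d, g (nrm x)
      = ∑' x : Vertex d, ∑' n : ℕ, (if nrm x = n then g n else 0) := tsum_congr h1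
    _ = ∑' n : ℕ, ∑' x : Vertex d, (if nrm x = n then g n else 0) := ENNReal.tsum_comm
    _ ≤ ∑' n : ℕ, (((2 * n + 1) ^ d : ℕ) : ℝ≥0∞) * g n := by
        refine ENNReal.tsum_le_tsum fun n => ?_
        rw [tsum_eq_sum (s := boxF d n)
          (fun x hx => if_neg fun h => hx (mem_boxF.2 h.le))]
        calc ∑ x ∈ boxF d n, (if nrm x = n then g n else 0) ≤ ∑ _x ∈ boxF d n, g n :=
              Finset.sum_le_sum fun x _ => by split_ifs <;> simp
          _ = (((2 * n + 1) ^ d : ℕ) : ℝ≥0∞) * g n := by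
              rw [Finset.sum_const, card_boxF, nsmul_eq_mul]

/-- The majorant series `Σ_n (2n+1)^d exp(−cn)` is finite in `ℝ≥0∞` (`c > 0`). -/
theorem tsum_layers_lt_top (d : ℕ) {c : ℝ} (hc : 0 < c) :
    ∑' n : ℕ, (((2 * n + 1) ^ d : ℕ) : ℝ≥0∞) * ENNReal.ofReal (Real.exp (-(c * n))) < ⊤ := by
  have hs : Summable fun n : ℕ => (2 * (n : ℝ) + 1) ^ d * Real.exp (-(c * n)) := by
    have h0 := Real.summable_pow_mul_exp_neg_nat_mul d hc
    have h1 := (summable_nat_add_iff 1).2 h0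
    refine Summable.of_nonneg_of_le (fun n => by positivity) (fun n => ?_)
      (h1.mul_left (3 ^ d * Real.exp c))
    have e1 : Real.exp (-(c * n)) = Real.exp c * Real.exp (-c * ((n + 1 : ℕ) : ℝ)) := by
      rw [← Real.exp_add]
      congr 1
      push_cast
      ring
    have e2 : (2 * (n : ℝ) + 1) ^ d ≤ 3 ^ d * ((n + 1 : ℕ) : ℝ) ^ d := by
      rw [← mul_pow]
      exact pow_le_pow_left₀ (by positivity) (by push_cast; linarith) d
    rw [e1]
    calc (2 * (n : ℝ) + 1) ^ d * (Real.exp c * Real.exp (-c * ((n + 1 : ℕ) : ℝ)))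
        ≤ 3 ^ d * ((n + 1 : ℕ) : ℝ) ^ d * (Real.exp c * Real.exp (-c * ((n + 1 : ℕ) : ℝ))) := by
          gcongr
      _ = 3 ^ d * Real.exp c * (((n + 1 : ℕ) : ℝ) ^ d * Real.exp (-c * ((n + 1 : ℕ) : ℝ))) := by
          ring
  have hterm : ∀ n : ℕ, (((2 * n + 1) ^ d : ℕ) : ℝ≥0∞) * ENNReal.ofReal (Real.exp (-(c * n)))
      = ENNReal.ofReal ((2 * (n : ℝ) + 1) ^ d * Real.exp (-(c * n))) := by
    intro n
    rw [ENNReal.ofReal_mul (by positivity), ← ENNReal.ofReal_natCast]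
    congr 2
    push_cast
    ring
  simp_rw [hterm]
  rw [← ENNReal.ofReal_tsum_of_nonneg (fun n => by positivity) hs]
  exact ENNReal.ofReal_lt_top

/-- Below `p_c`, the susceptibility is finite (S1′ and the layer count), for `d ≥ 1`. -/
theorem chi_lt_top_of_lt_pc (hd : 1 ≤ d) (hP5 : P5_Sharpness d) (p : I) (hp : (p : ℝ) < pc d) :
    chi d p < ⊤ := by
  obtain ⟨c, hc, hdecay⟩ := exists_decay hd hP5 p hp
  calc chi d p ≤ ∑' x : Vertex d, ENNReal.ofReal (Real.exp (-(c * nrm x))) :=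
        ENNReal.tsum_le_tsum hdecay
    _ ≤ ∑' n : ℕ, (((2 * n + 1) ^ d : ℕ) : ℝ≥0∞) * ENNReal.ofReal (Real.exp (-(c * n))) :=
        tsum_nrm_le _
    _ < ⊤ := tsum_layers_lt_top d hc

/-- `(clamp q : ℝ) = q` for `q ∈ [0,1]`. -/
theorem coe_clamp_of_mem {q : ℝ} (hq : q ∈ Set.Icc (0 : ℝ) 1) : ((clamp q : I) : ℝ) = q := by
  unfold clamp
  rw [Set.projIcc_of_mem _ hq]

/-- `p_c(d) ≤ p_c^χ(d)` for `d ≥ 1`, given sharpness in dimension `d`. -/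
theorem pc_le_pcChi (hd : 1 ≤ d) (hP5 : P5_Sharpness d) : pc d ≤ pcChi d := by
  by_contra hlt'
  have hlt : pcChi d < pc d := not_le.1 hlt'
  have h0 : (0 : ℝ) ≤ pcChi d := pcChi_nonneg
  set q : ℝ := (pcChi d + pc d) / 2 with hq
  have hq0 : 0 ≤ q := by linarith
  have hq1 : q < pc d := by linarith
  have hq1' : q ≤ 1 := hq1.le.trans (pc_le_one hd)
  have hmem : q ∈ chiSet d := by
    refine ⟨⟨hq0, hq1'⟩, ?_⟩
    apply chi_lt_top_of_lt_pc hd hP5 (clamp q)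
    rw [coe_clamp_of_mem ⟨hq0, hq1'⟩]
    exact hq1
  have : q ≤ pcChi d := le_csSup chiSet_bddAbove hmem
  linarith

/-! ## S5 · PC-CHI and the transfer of H1 -/

/-- S5 · PC-CHI on Defs: `p_c^χ(d) = p_c(d)` for `d ≥ 1`, given P5 · SHARPNESS (S1′ form) in
dimension `d`. -/
theorem pcChi_eq_pc (hd : 1 ≤ d) (hP5 : P5_Sharpness d) : pcChi d = pc d :=
  le_antisymm (pcChi_le_pc hd) (pc_le_pcChi hd hP5)

/-- H1 at the print's `p_c^χ` transfers to the route's `H1_Triangle11` (at `p_c`), given sharpness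
in every dimension `d ≥ 11`. -/
theorem H1_Triangle11_of_chi (h : H1_TriangleChi11) (hP5 : ∀ d : ℕ, 11 ≤ d → P5_Sharpness d) :
    H1_Triangle11 := by
  intro d hd
  have := h d hd
  rwa [pcChi_eq_pc (by omega) (hP5 d hd)] at this

end Summit.Ventures.PercRepro0.PcChi
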